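import Summits.BirchSwinnertonDyer.BirchSwinnertonDyer.Theorems.SignedBaseChangeAnticyclotomicEisensteinDivisibilityAwayDiscrepancyKernel
import Literature.NumberTheory.EllipticCurves.GreenbergVatsal2000.GreenbergSelmerGroups
import Literature.NumberTheory.EllipticCurves.SubgroupSelmerCocycleCriteriaProofs
import HarnessLib

/-!
# The away-from-`p` discrepancy "unramified vs. locally trivial" over a `ℤ_p`-tower, LOCAL part
# (crux `AnticyclotomicEisensteinDivisibility`, stmt-BirchSwinnertonDyer-20727, line `bdpline`,
# registered stub `stub_awayDiscrepancySS`; helper): at a finite place `v ∤ p` whose decomposition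
# group lies in `H`, an unramified class of `H¹(H, E[p^∞])` is locally trivial after multiplication by
# a bounded integer `t_v ≠ 0` (and with `t_v = 1` at a place of good reduction)

Lead seat bsd-line-sbc-p1 gen 3 (2026-08-28); sequel of `…AwayDiscrepancyKernel.lean` (the engine
`nsmul_eq_zero_of_resOfLe_eq_zero_of_frobenius_generation`).

* §1 `exists_nsmul_frob_sub_eq` — at ANY `v ∤ p` (good or bad) the cokernel of `Frob − 1` on
  `E[p^∞]^{I_v}` has bounded exponent: `t = #ker(Frob − 1 | E[p^∞]^{I_v})` works (the kernel lies in
  `E[p^∞]^{D_v}`, finite by the tree's `finite_setOf_forall_decompositionSubgroup_smul_eq`; on each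
  finite `Frob`-stable piece `E[p^∞]^{I_v}[p^n]` the index of the image of `Frob − 1` is the order of
  its kernel, which divides `t`).
* §2 the local lemmas for a subgroup `H ≥ D_v` (e.g. `H = Gal(K̄/K_∞⁻)` at a place splitting
  completely in the anticyclotomic tower): `mem_awayKer_of_mem_unramifiedKer_of_decomp_le` (GOOD `v`:
  unramified ⟹ locally trivial, Greenberg's Lemma 3.3, by the tree's
  `resOfLe_injective_of_frobenius_generation`) and `exists_nsmul_mem_awayKer_of_decomp_le` (ANY `v ∤ p`:
  after multiplication by `t_v`).

Theorems only (no definition, no named fact, no `sorry`); closes nothing by itself. BSD is not proved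
by any of this.

References: R. Greenberg, LNM 1716 (1999), §3 Lemma 3.3 (p. 87); J.-P. Serre, *Galois Cohomology*,
I §2.6 (b), I §5.1; J. S. Milne, *Arithmetic Duality Theorems*, I §2 Lemma 2.10; F. Castella, Camb.
J. Math. 6 (2018), §2.2 (`ℋ^ur_w`); R. Greenberg, V. Vatsal, Invent. Math. 142 (2000), §2 p. 17.
-/

-- D-0017: single-problem summit, the namespace repeats the problem name by design.
set_option linter.dupNamespace false
set_option autoImplicit false

noncomputable section

open scoped Classical AddSubgroup

open NumberField IsDedekindDomain Field
open Literature.NumberTheory.EllipticCurves Literature.NumberTheory.EllipticCurves.GreenbergSelmer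
  Literature.NumberTheory.EllipticCurves.GreenbergVatsal2000 Literature.NumberTheory.GaloisRepresentations
  IsDedekindDomain.HeightOneSpectrum

namespace Summit.BirchSwinnertonDyer.BirchSwinnertonDyer.Theorems.SignedBaseChangeAcDivAwayDiscrepancy

open Summit.BirchSwinnertonDyer.Rank1Residual.X11b.AcSelmer
  Summit.BirchSwinnertonDyer.Rank1Residual.GaloisImage.InertiaDivisible

/-! ## §1 At `v ∤ p`: `Frob − 1` hits `t · E[p^∞]^{I_v}` for `t = #ker(Frob − 1 | E[p^∞]^{I_v})` -/

section Curve

variable {K : Type} [Field K] [NumberField K] (E : WeierstrassCurve K) [E.IsElliptic]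
  (p : ℕ) [Fact p.Prime]

omit [NumberField K] in
/-- `E[p^∞][p^n]` is finite, as a subtype (it embeds in `E[p^n]`, Silverman III.6.4).
[cite: SilvermanAEC2009, Cor. III.6.4] -/
theorem finite_subtype_pow_smul_eq_zero (n : ℕ) :
    Finite {m : E.geomPrimaryTorsion p // p ^ n • m = 0} := by
  have hn : ((p ^ n : ℕ) : ℤ) ≠ 0 := by exact_mod_cast pow_ne_zero n (Fact.out : p.Prime).ne_zero
  haveI : Finite (E.geomTorsion ((p ^ n : ℕ) : ℤ)) :=
    WeierstrassCurve.finite_torsionPoints_holds E (AlgebraicClosure K) hn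
  refine Finite.of_injective (fun m ↦ (⟨((m : E.geomPrimaryTorsion p) : E.geomPoints), ?_⟩ :
    E.geomTorsion ((p ^ n : ℕ) : ℤ))) ?_
  · rw [AddSubgroup.torsionBy.nsmul_iff]
    have := congrArg (fun z : E.geomPrimaryTorsion p ↦ (z : E.geomPoints)) m.2
    simpa only [AddSubmonoidClass.coe_nsmul, ZeroMemClass.coe_zero] using this
  · intro a b hab
    apply Subtype.ext; apply Subtype.ext
    exact congrArg (fun z : E.geomTorsion ((p ^ n : ℕ) : ℤ) ↦ (z : E.geomPoints)) hab

/-- **At ANY finite place `v ∤ p` (good or bad), the cokernel of `Frob − 1` on the inertia invariants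
`E[p^∞]^{I_v}` has bounded exponent**: with `φ` an arithmetic Frobenius at the chosen prime `𝔓₀ ∣ v`,
`I = I_{𝔓₀}`, there is `t ≠ 0` such that every `m ∈ E[p^∞]^I` has `t·m = φ b − b` for some `b ∈ E[p^∞]^I`.
Proof: `T = φ − 1` preserves `N = E[p^∞]^I` (`I` is normalised by `φ`) and each finite piece `N[p^n]`;
`ker T ⊆ E[p^∞]^{D_v}` is FINITE (a point fixed by `I` and `φ` is fixed by `D_v`; the tree's
`finite_setOf_forall_decompositionSubgroup_smul_eq`, i.e. `E(K_v)[p^∞]` is finite); on the finite group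
`N[p^n] ∋ m` the image of `T` has index `#ker(T|N[p^n]) ∣ #ker T =: t`. ("`H¹(K_v^nr/K_v, E[p^∞]^{I_v})
= E[p^∞]^{I_v}/(Frob − 1)` is finite", Greenberg LNM 1716 p. 87; Milne ADT I Lemma 2.10.)
[cite: GreenbergLNM1716, §3 Lemma 3.3 and p. 87] [cite: MilneADT2006, Ch. I §2 Lemma 2.10] -/
theorem exists_nsmul_frob_sub_eq {v : HeightOneSpectrum (𝓞 K)} (hpv : (p : 𝓞 K) ∉ v.asIdeal)
    {φ : absoluteGaloisGroup K} (hφ : IsArithFrobAt (𝓞 K) φ (adicCompletionPrime K v)) :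
    ∃ t : ℕ, t ≠ 0 ∧ ∀ m : E.geomPrimaryTorsion p,
      (∀ i ∈ (adicCompletionPrime K v).inertia (absoluteGaloisGroup K), i • m = m) →
        ∃ b : E.geomPrimaryTorsion p,
          (∀ i ∈ (adicCompletionPrime K v).inertia (absoluteGaloisGroup K), i • b = b) ∧
            φ • b - b = t • m := by
  set I := (adicCompletionPrime K v).inertia (absoluteGaloisGroup K) with hIdef
  have h𝔓₀ := adicCompletionPrime_mem_primesAbove K v
  haveI : (adicCompletionPrime K v).IsPrime := h𝔓₀.1
  have hφD : φ ∈ (adicCompletionPrime K v).decompositionSubgroup (absoluteGaloisGroup K) :=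
    hφ.mem_stabilizer
  -- the invariants `N = E[p^∞]^I`, stable under `φ`
  let N : AddSubgroup (E.geomPrimaryTorsion p) :=
    { carrier := {m | ∀ i ∈ I, i • m = m}
      zero_mem' := fun i _ ↦ smul_zero i
      add_mem' := fun {a b} ha hb i hi ↦ by rw [smul_add, ha i hi, hb i hi]
      neg_mem' := fun {a} ha i hi ↦ by rw [smul_neg, ha i hi] }
  have hmemN : ∀ {m : E.geomPrimaryTorsion p}, m ∈ N ↔ ∀ i ∈ I, i • m = m := fun {m} ↦ Iff.rfl
  have hφN : ∀ m ∈ N, φ • m ∈ N := fun m hm ↦ by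
    rw [hmemN] at hm ⊢
    intro i hi
    have hi' : φ⁻¹ * i * φ ∈ I := inv_mul_mul_mem_inertia_adicCompletionPrime v hφD hi
    calc i • φ • m = φ • ((φ⁻¹ * i * φ) • m) := by
          rw [← mul_smul, ← mul_smul]; congr 1; group
      _ = φ • m := by rw [hm _ hi']
  -- `T = φ − 1` on `N`
  let T : N →+ N :=
    { toFun := fun m ↦ ⟨φ • (m : E.geomPrimaryTorsion p) - m, N.sub_mem (hφN _ m.2) m.2⟩
      map_zero' := Subtype.ext (by simp)
      map_add' := fun a b ↦ Subtype.ext (by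
        simp only [AddSubgroup.coe_add, smul_add, AddMemClass.mk_add_mk]; abel) }
  have hT : ∀ m : N, ((T m : N) : E.geomPrimaryTorsion p) = φ • (m : E.geomPrimaryTorsion p) - m :=
    fun _ ↦ rfl
  -- `ker T` is finite: its points are fixed by `I` and `φ`, hence by `D_{𝔓₀}`
  have hfin := finite_setOf_forall_decompositionSubgroup_smul_eq E p hpv (v := v)
  haveI hfinker : Finite T.ker := by
    haveI := hfin.to_subtype
    let F : T.ker → {t : E.geomPrimaryTorsion p |
        ∀ d ∈ (adicCompletionPrime K v).decompositionSubgroup (absoluteGaloisGroup K), d • t = t} :=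
      fun x ↦ ⟨((x : N) : E.geomPrimaryTorsion p), fun d hd ↦
        smul_eq_of_mem_decompositionSubgroup_of_inertia_of_frob E p v hφ (x : N).2
          (sub_eq_zero.mp (by
            have h := (AddMonoidHom.mem_ker).mp x.2
            rw [← hT]; rw [h]; rfl)) hd⟩
    refine Finite.of_injective F fun a b hab ↦ ?_
    have h := congrArg Subtype.val hab
    exact Subtype.ext (Subtype.ext h)
  refine ⟨Nat.card T.ker, (Nat.card_pos (α := T.ker)).ne', fun m hm ↦ ?_⟩
  -- the finite piece `N[p^n] ∋ m`
  obtain ⟨n, hn0⟩ := m.2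
  have hn : p ^ n • m = 0 :=
    Subtype.ext (by rw [AddSubmonoidClass.coe_nsmul, ZeroMemClass.coe_zero]; exact hn0)
  let Nn : AddSubgroup N :=
    { carrier := {x | p ^ n • ((x : N) : E.geomPrimaryTorsion p) = 0}
      zero_mem' := by simp
      add_mem' := fun {a b} ha hb ↦ by
        simp only [Set.mem_setOf_eq, AddSubgroup.coe_add, smul_add] at ha hb ⊢
        rw [ha, hb, add_zero]
      neg_mem' := fun {a} ha ↦ by
        simp only [Set.mem_setOf_eq, AddSubgroup.coe_neg, smul_neg] at ha ⊢
        rw [ha, neg_zero] }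
  have hmemNn : ∀ {x : N}, x ∈ Nn ↔ p ^ n • ((x : N) : E.geomPrimaryTorsion p) = 0 :=
    fun {x} ↦ Iff.rfl
  haveI : Finite Nn := by
    haveI := finite_subtype_pow_smul_eq_zero E p n
    let F : Nn → {m : E.geomPrimaryTorsion p // p ^ n • m = 0} :=
      fun x ↦ ⟨(((x : Nn) : N) : E.geomPrimaryTorsion p), x.2⟩
    refine Finite.of_injective F fun a b hab ↦ ?_
    have h := congrArg Subtype.val hab
    exact Subtype.ext (Subtype.ext h)
  -- `T` restricted to the finite piece
  have hTNn : ∀ x ∈ Nn, T x ∈ Nn := fun x hx ↦ by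
    rw [hmemNn] at hx ⊢
    rw [hT, smul_sub, smul_comm, hx, smul_zero, sub_zero]
  let Tn : Nn →+ Nn :=
    { toFun := fun x ↦ ⟨T x.1, hTNn _ x.2⟩
      map_zero' := Subtype.ext (map_zero T)
      map_add' := fun a b ↦ Subtype.ext (map_add T a.1 b.1) }
  -- `#ker Tn ∣ #ker T`
  have hdvd : Nat.card Tn.ker ∣ Nat.card T.ker := by
    let j : Tn.ker →+ T.ker :=
      { toFun := fun x ↦ ⟨((x : Nn) : N), (AddMonoidHom.mem_ker).mpr
          (congrArg Subtype.val ((AddMonoidHom.mem_ker).mp x.2))⟩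
        map_zero' := rfl
        map_add' := fun _ _ ↦ rfl }
    refine AddSubgroup.card_dvd_of_injective j fun a b hab ↦ ?_
    have h := congrArg Subtype.val hab
    exact Subtype.ext (Subtype.ext h)
  obtain ⟨q, hq⟩ := hdvd
  -- `#ker Tn · m ∈ range Tn`
  have hmNn : (⟨m, hm⟩ : N) ∈ Nn := hn
  obtain ⟨b, hb⟩ := card_ker_nsmul_mem_range Tn ⟨⟨m, hm⟩, hmNn⟩
  refine ⟨q • (((b : Nn) : N) : E.geomPrimaryTorsion p), fun i hi ↦ ?_, ?_⟩
  · rw [smul_comm, ((b : Nn) : N).2 i hi]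
  · have h := congrArg (fun z : Nn ↦ ((z : N) : E.geomPrimaryTorsion p)) hb
    have hl : (fun z : Nn ↦ ((z : N) : E.geomPrimaryTorsion p)) (Tn b) =
        φ • (((b : Nn) : N) : E.geomPrimaryTorsion p) - ((b : Nn) : N) := rfl
    have hr : (fun z : Nn ↦ ((z : N) : E.geomPrimaryTorsion p))
        (Nat.card Tn.ker • (⟨⟨m, hm⟩, hmNn⟩ : Nn)) = Nat.card Tn.ker • m := by
      show (((Nat.card Tn.ker • (⟨⟨m, hm⟩, hmNn⟩ : Nn) : Nn) : N) : E.geomPrimaryTorsion p) =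
        Nat.card Tn.ker • m
      rw [AddSubmonoidClass.coe_nsmul, AddSubmonoidClass.coe_nsmul]
    have h' : φ • (((b : Nn) : N) : E.geomPrimaryTorsion p) - ((b : Nn) : N) = Nat.card Tn.ker • m :=
      hl.symm.trans (h.trans hr)
    rw [smul_comm φ q, ← smul_sub, h', hq, mul_comm, mul_smul]

/-! ## §2 The local lemmas for a subgroup `H ≥ D_v` -/

omit [E.IsElliptic] [Fact p.Prime] in
/-- An unramified class (`unramifiedKer H M v`, vanishing on `H ⊓ I_v` read inside `D_v`) restricts to
`0` on the inertia group `I_{𝔓₀} ≤ H` of the chosen prime (the two inertia spellings agree,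
`inertia_adicCompletionPrime_eq_map_absInertia`). [cite: GreenbergVatsal2000, §2 p. 17] -/
theorem resOfLe_inertia_eq_zero_of_mem_unramifiedKer {v : HeightOneSpectrum (𝓞 K)}
    {H : Subgroup (absoluteGaloisGroup K)}
    (hIH : (adicCompletionPrime K v).inertia (absoluteGaloisGroup K) ≤ H)
    {y : E.subgroupH1 p H} (hy : y ∈ unramifiedKer H (E.geomPrimaryTorsion p) v) :
    resOfLe (E.geomPrimaryTorsion p) hIH y = 0 := by
  obtain ⟨ψ, rfl⟩ := oneCocycleClass_surjective _ y
  rw [GreenbergVatsal2000.unramifiedKer, AddMonoidHom.mem_ker,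
    CocycleCriteria.resH1Hom_oneCocycleClass_eq_zero_iff] at hy
  obtain ⟨a, ha⟩ := hy
  rw [CocycleCriteria.resOfLe_oneCocycleClass_eq_zero_iff]
  refine ⟨a, fun x ↦ ?_⟩
  have hxI : (x : absoluteGaloisGroup K) ∈ inertia v := by
    show (x : absoluteGaloisGroup K) ∈
      (absInertia (v.adicCompletion K)).map (absGaloisRestrict K (v.adicCompletion K)).toMonoidHom
    rw [← inertia_adicCompletionPrime_eq_map_absInertia]
    exact x.2
  have hxD : (x : absoluteGaloisGroup K) ∈ decomp v := inertia_le_decomp v hxI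
  have hxH : (x : absoluteGaloisGroup K) ∈ H := hIH x.2
  let x' : inertiaIn H v := ⟨⟨(x : absoluteGaloisGroup K), hxD⟩,
    (mem_inertiaIn_iff H v _).2 ⟨hxH, hxI⟩⟩
  have key := ha x'
  rw [AddMonoidHom.id_apply] at key
  have e : (inertiaInToH H v x' : H) = Subgroup.inclusion hIH x := Subtype.ext rfl
  rw [e] at key
  exact key

/-- **Unramified ⟹ locally trivial at a GOOD `v ∤ p` splitting completely** (`D_v ≤ H`): for an
elliptic curve `E/K`, a good place `v ∤ p`, and any subgroup `H ≤ Γ_K` containing the decomposition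
group `D_v` of the chosen prime, `unramifiedKer H E[p^∞] v ≤ awayKer H E[p^∞] v` — Greenberg's
Lemma 3.3 (`H¹_ur(K_v, E[p^∞]) = E[p^∞]/(Frob − 1) = 0`) on `H ⊓ D_v`, by the tree's engine
`resOfLe_injective_of_frobenius_generation` (`I_v` acts trivially, `Frob − 1` is onto `E[p^∞]`).
[cite: GreenbergLNM1716, §3 Lemma 3.3 (p. 87)] [cite: Castella2018, §2.2 (arXiv:1704.06608 p. 7)] -/
theorem mem_awayKer_of_mem_unramifiedKer_of_decomp_le {v : HeightOneSpectrum (𝓞 K)}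
    (hpv : (p : 𝓞 K) ∉ v.asIdeal) (hv : E.HasGoodReductionAt v)
    {H : Subgroup (absoluteGaloisGroup K)} (hDH : decomp v ≤ H)
    {y : E.subgroupH1 p H} (hy : y ∈ unramifiedKer H (E.geomPrimaryTorsion p) v) :
    y ∈ awayKer H (E.geomPrimaryTorsion p) v := by
  have h𝔓₀ := adicCompletionPrime_mem_primesAbove K v
  haveI : (adicCompletionPrime K v).IsPrime := h𝔓₀.1
  have e : decomp v = (adicCompletionPrime K v).decompositionSubgroup (absoluteGaloisGroup K) := by
    rw [decompositionSubgroup_adicCompletionPrime_eq_range]; rfl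
  have hIH : (adicCompletionPrime K v).inertia (absoluteGaloisGroup K) ≤ H :=
    (inertia_adicCompletionPrime_le_decomp v).trans hDH
  have hID : (adicCompletionPrime K v).inertia (absoluteGaloisGroup K) ≤ H ⊓ decomp v :=
    le_inf hIH (inertia_adicCompletionPrime_le_decomp v)
  obtain ⟨φ, hφ⟩ := exists_isArithFrobAt_of_mem_primesAbove_holds h𝔓₀
  have hφD : φ ∈ decomp v := by rw [e]; exact hφ.mem_stabilizer
  have hinj := resOfLe_injective_of_frobenius_generation (M := E.geomPrimaryTorsion p) hID
    (Subgroup.mem_inf.mpr ⟨hDH hφD, hφD⟩) (fun U hU d hd ↦ by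
      have hd' : d ∈ (adicCompletionPrime K v).decompositionSubgroup (absoluteGaloisGroup K) := by
        rw [← e]; exact (Subgroup.mem_inf.mp hd).2
      exact exists_eq_frobenius_pow_mul_of_mem_decompositionSubgroup h𝔓₀ hφ hU hd')
    (E.continuous_smul_geomPrimaryTorsion p)
    (fun i hi m ↦ smul_geomPrimaryTorsion_eq_of_mem_inertia E p hpv hv h𝔓₀ hi m)
    (exists_frob_smul_sub_eq E p hpv hv h𝔓₀ hφ)
  rw [awayKer, AddMonoidHom.mem_ker]
  apply hinj
  rw [map_zero, ← AddMonoidHom.comp_apply, resOfLe_comp_holds]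
  exact resOfLe_inertia_eq_zero_of_mem_unramifiedKer E p hIH hy

/-- **Unramified ⟹ locally trivial after a bounded integer, at ANY `v ∤ p` splitting completely.**
For an elliptic curve `E/K` and a finite place `v ∤ p` (good OR bad) there is ONE `t ≠ 0` such that for
every subgroup `H ≥ D_v` and every `y ∈ H¹(H, E[p^∞])` unramified at the chosen place above `v`,
`t·y` is locally trivial there (`awayKer`): on `H ⊓ D_v` the class `y` dies on `I_{𝔓₀}`, and §1 applies
with §2's `t` ("`ℋ^ur_v = H¹(K_v^nr/K_v, E[p^∞]^{I_v})` is finite of bounded exponent").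
[cite: GreenbergLNM1716, §3 p. 87] [cite: MilneADT2006, Ch. I §2 Lemma 2.10]
[cite: Castella2018, §2.2 (arXiv:1704.06608 p. 7)] -/
theorem exists_nsmul_mem_awayKer_of_decomp_le {v : HeightOneSpectrum (𝓞 K)}
    (hpv : (p : 𝓞 K) ∉ v.asIdeal) :
    ∃ t : ℕ, t ≠ 0 ∧ ∀ (H : Subgroup (absoluteGaloisGroup K)), decomp v ≤ H →
      ∀ y : E.subgroupH1 p H, y ∈ unramifiedKer H (E.geomPrimaryTorsion p) v →
        t • y ∈ awayKer H (E.geomPrimaryTorsion p) v := by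
  have h𝔓₀ := adicCompletionPrime_mem_primesAbove K v
  haveI : (adicCompletionPrime K v).IsPrime := h𝔓₀.1
  have e : decomp v = (adicCompletionPrime K v).decompositionSubgroup (absoluteGaloisGroup K) := by
    rw [decompositionSubgroup_adicCompletionPrime_eq_range]; rfl
  obtain ⟨φ, hφ⟩ := exists_isArithFrobAt_of_mem_primesAbove_holds h𝔓₀
  have hφD : φ ∈ decomp v := by rw [e]; exact hφ.mem_stabilizer
  obtain ⟨t, ht0, ht⟩ := exists_nsmul_frob_sub_eq E p hpv hφ
  refine ⟨t, ht0, fun H hDH y hy ↦ ?_⟩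
  have hIH : (adicCompletionPrime K v).inertia (absoluteGaloisGroup K) ≤ H :=
    (inertia_adicCompletionPrime_le_decomp v).trans hDH
  have hID : (adicCompletionPrime K v).inertia (absoluteGaloisGroup K) ≤ H ⊓ decomp v :=
    le_inf hIH (inertia_adicCompletionPrime_le_decomp v)
  rw [awayKer, AddMonoidHom.mem_ker, map_nsmul]
  refine nsmul_eq_zero_of_resOfLe_eq_zero_of_frobenius_generation (M := E.geomPrimaryTorsion p) hID
    (fun d hd i hi ↦ inv_mul_mul_mem_inertia_adicCompletionPrime v
      (by rw [← e]; exact (Subgroup.mem_inf.mp hd).2) hi)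
    (Subgroup.mem_inf.mpr ⟨hDH hφD, hφD⟩) (fun U hU d hd ↦ by
      have hd' : d ∈ (adicCompletionPrime K v).decompositionSubgroup (absoluteGaloisGroup K) := by
        rw [← e]; exact (Subgroup.mem_inf.mp hd).2
      exact exists_eq_frobenius_pow_mul_of_mem_decompositionSubgroup h𝔓₀ hφ hU hd')
    (E.continuous_smul_geomPrimaryTorsion p) t ht ?_
  rw [← AddMonoidHom.comp_apply, resOfLe_comp_holds]
  exact resOfLe_inertia_eq_zero_of_mem_unramifiedKer E p hIH hy

end Curve

end Summit.BirchSwinnertonDyer.BirchSwinnertonDyer.Theorems.SignedBaseChangeAcDivAwayDiscrepancy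

end
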